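import Literature.AlgebraicGeometry.HodgeTheory.WeilTypeSecondCohomologyK3Type
import Literature.AlgebraicGeometry.HodgeTheory.WeilClassesSixfoldsProofs
import Literature.AlgebraicGeometry.VanGeemen1994.WeilTypeHodgeRingOfSU
import Literature.AlgebraicGeometry.Hyperkaehler.K3HilbertSquareTypeCohomology
import Literature.AlgebraicGeometry.Hyperkaehler.KummerTypeAssociatedK3Surface
import Literature.AlgebraicGeometry.Hyperkaehler.BeauvilleBogomolovMarkingsExist
import Literature.AlgebraicGeometry.Motives.HodgeStructureQuotient
import HarnessLib

/-!
# The Kummer fourfold of a very general discriminant-one Weil fourfold lies in a projective hyperkähler sixfold of `K3^[3]` type, and `q_X^∨ ∝ c₂(T_X)` pulls back to an algebraic class off the divisor ring (van Geemen–Rapagnetta 2026, Thms. 0.2–0.3) — NAMED FACTS + kernel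

[topic AlgebraicGeometry/HodgeTheory]

Layer `Literature/AlgebraicGeometry/HodgeTheory`; cross-ladder literature-typing layer (D-0088(4), tranche
LT-H4 "recent-theorem open-question harvest", seat `hodge-lit-oqh-1` gen 5; companion of
`WeilTypeSecondCohomologyK3Type` (the same paper's §1: Lombardo's `T ⊂ H²(B,ℚ)`, "no K3-type sub-Hodge
structure for `n > 2`") and of `WeilFourfoldsDiscOneKugaSatake`).  WHAT IS TYPED: the paper's two MAIN
theorems — the FOURTH proof in print of the Hodge conjecture for discriminant-one Weil fourfolds, and the
only one whose MECHANISM is a map from the abelian variety INTO a hyperkähler manifold carrying a natural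
algebraic class — in their cohomological shadow on the tree's carriers, graded **PREPRINT** (arXiv, July
2026), plus the kernel consequences BY NAME.  LADDER READING (HodgeAV, rung H2 = Weil SIXFOLDS, transfer
lens "Kummer variety of a Weil-type abelian variety inside a hyperkähler host"): at `n = 2` the host
EXISTS (this file); at `n ≥ 3` NO Hodge morphism from an irreducible K3-type structure (such as the
transcendental lattice `T_X` of any projective hyperkähler `X`) into `H²(B, ℚ)` of a general Weil `2n`-fold
is non-zero (`hom_eq_zero_of_isIrreducible_of_isOfK3Type`, PROVED here from the §1.15 record of the
companion file) — the printed obstruction "there cannot exist such a map to a hyperkähler manifold".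
HONEST FRAMING: typed ≠ proved ≠ endorsed; nothing here asserts HC / HC_AV / W₆ / HC_Kum4Type beyond the
ONE member the existential fact names (for which HC is then a kernel theorem modulo named facts).

## Source (read at source; locators = files of the materialised arXiv text `paper:arxiv-2607.18341`)

B. van Geemen, A. Rapagnetta, *Hyperkähler sixfolds, abelian fourfolds of Weil type and a Hodge class*,
arXiv:2607.18341 (20 Jul 2026) [`vanGeemenRapagnetta2026WeilHK`; **PREPRINT**].  Verbatim:
* Abstract [p0001:L4–L8]: "The abelian fourfolds under consideration allow a map to a hyperkähler sixfold
  of K3^[3] type. The pull-back of the second Chern class of the tangent bundle of the sixfold is an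
  algebraic class in codimension two that is not an intersection of divisor classes and the main result
  follows."
* **Theorem 0.2** [p0002:L17–L21]: "Let `B′` be a very general abelian fourfold of Weil type, for an
  imaginary quadratic field `K`, with trivial discriminant.  Then `B′` is isogeneous to an abelian fourfold
  `B` such that the Kummer variety `K(B)` of `B` is a submanifold of a six-dimensional projective
  hyperkähler manifold `X` of K3^[3] type whose transcendental Hodge structure `T_X ⊂ H²(X,ℚ)` has
  dimension six."  (p0002:L15: "The manifold `X` 'replaces' the singular OG6 variety in [FF25, Theorem
  1.3]"; proof: §7, deformation of the pair `(K(A × A) ⊂ M)` over a 5-dimensional base, p0047:L20–L30: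
  "any such field `K` occurs. We find complete four dimensional families of abelian varieties in this way".)
* **Theorem 0.3** [p0002:L26–L31]: "Let `B′` be a very general abelian fourfold of Weil type with
  imaginary quadratic field `K` and discriminant one. Let `B′ → B ⇢ K(B) ↪ X` be the composition of the
  maps in Theorem 0.2. Then the pull-back of the second Chern class `c₂(T_X)` of the tangent bundle of `X`
  to `B′` is a Hodge-Weil class which is also algebraic. Therefore all Hodge-Weil classes in `HW(B′, K)`
  are algebraic."
* §1.13 [p0012:L32–L42, p0013:L2–L9]: for `X` of K3^[3] type "`H⁴(X,ℤ) ≅ Sym²H²(X,ℤ) ⊕ H²(X,ℤ)(−1)`",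
  "The class `q_X^∨ ∈ Sym²H²(X,ℤ)` defined by the BBF form is, up to a non-zero scalar multiple, the second
  Chern class of `X`: `q_X^∨ = λc₂(X)`, `λ ∈ ℚ`, `λ ≠ 0`" (proof via a very general non-projective
  deformation, special Mumford–Tate group `SO(q_X)`, Lemma 1.10, "`c₂(T_X)³ = 36800 ≠ 0`").
* §1.14, proof of Thm. 0.3 [p0013:L10–L33]: "the pull-back of a non-zero holomorphic 2-form on `X` to `B`
  must be a non-zero holomorphic 2-form on `B` […] Hence we obtain an injective map from the
  transcendental lattice `T_X` of `X` into `H²(B,ℤ)` […] This induces an isomorphism of rational Hodge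
  structures `Sym²(T_X) → Sym²(T₁)`. The Hodge class `q_X^∨` maps to a non-zero element in `Sym²(T₁)`
  which must be a scalar multiple of `q₁^∨`. By Proposition 1.11, `q₁^∨` maps to a non-zero Hodge-Weil
  class in `HW(B,K) ⊂ H⁴(B,ℚ)`. […] Since `X` is projective, `c₂(T_X)` is algebraic and since `q_X^∨` and
  `c₂(X)` are proportional, also `q_X^∨` is algebraic. Hence the pull-back of that algebraic cycle
  represents a Hodge-Weil class, which is thus also algebraic.  As observed earlier, this implies, using
  the `K`–action, that then all Hodge-Weil classes in `B` are algebraic."  Prop. 1.11 [p0011:L32–p0012:L25]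
  ("`B` very general […] of Weil type with discriminant one", special Mumford–Tate group `SU(2,2)`, Thm. 1.8).
* Intro, last paragraph before the construction [p0003:L12–L16]: "a 2–cycle on `B′` that, up to a
  complete intersection of divisors, defines a Hodge-Weil class. This observation might be useful to find
  explicit surfaces in `B′` with a cohomology class that is not a complete intersection of divisor classes."
* §1.15 [p0013:L34–L50] — typed in the companion file (`…_K3Type_subHodgeStructures_generalWeilType`).
Refereed context cited by name: Floccari–Fu, JMPA 210 (2026) Thm. 1.3 (the OG6 version of the mechanism;
`FloccariFu2026`, not nameable on the tree's carriers — module docstring of `Hyperkaehler/OGradySixType`);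
Markman, JEMS 25 (2023) Thm. 1.5 (= Thm. 0.1 here; tree record
`Markman2023_weilClasses_algebraic_discOneWeilFourfold`); O'Grady, Commun. Contemp. Math. 10 (2008) §2–3
(`OGrady2008NumericalK3Square`; the `K3^[2]` twin `OGrady2008_dualBBFClass_algebraic`).

## Rendering (tree carriers; what each clause says, and what is WEAKER than print)

* "very general abelian fourfold of Weil type for `K = ℚ(√-d)` with trivial discriminant […] isogenous to
  `B`" ↦ EXISTENTIAL over the member: `∃ m > 0, ∃ (B, ψ)` with `IsSplitWeilType B ψ 2 (m²·d)` (discriminant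
  one = split = hyperbolic for fourfolds, file `WeilTypeAbelianVariety`; `√-d ∈ End⁰(B)` only, so an integral
  multiple `ψ = m√-d ∈ End(B)`, `ψ² = -m²d`, same field) AND Mumford–Tate genericity
  `VanGeemen1994.HasHodgeGroupSU B ψ 2 (m²d) h` for a `K`-symmetrised hyperplane class `h` (print: `B′` very
  general, §1.14 uses Thm. 1.8 / Prop. 1.11 for `B`, both under "special Mumford–Tate group `SU(2,2)`";
  very general members with Hodge group `SU_H` exist and isogeny preserves the Hodge group).  WEAKER than
  print: we assert SOME such `B` per field, not "every very general `B′` up to isogeny" (no carrier for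
  "very general"; asserting it for every `B` with Hodge group `SU_H` would be STRONGER than print).
* "`K(B)` is a submanifold of a six-dimensional projective hyperkähler `X` of K3^[3] type, `dim T_X = 6`" ↦
  `IsSmoothProjective 6 X ∧ Hyperkaehler.IsOfK3HilbertType 3 X` and `finrank_ℂ (transcendentalPart X b) = 6`
  for every Fujiki form `b` (`Hyperkaehler.transcendentalPart X b = NS(X)^{⊥_b} ⊗ ℂ`, file
  `KummerTypeAssociatedK3Surface`; insensitive to the free scalar of `b`).  The Kummer variety `K(B)` and the
  rational map `B ⇢ K(B) ⊂ X` have no carrier; what is typed is their COHOMOLOGICAL SHADOW: the pull-backs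
  `f₂ : H²(X(ℂ); ℂ) → H²(B(ℂ); ℂ)` and `f₄ : H⁴(X(ℂ); ℂ) → H⁴(B(ℂ); ℂ)` along the closure of the graph
  `Γ̄ ⊂ B × X` (the map is a morphism off the 256 two-torsion points, codimension 4, so `f^* = [Γ̄]^*` on
  `H^{≤ 6}` and `f^*` is multiplicative): `IsAlgebraicCorrespondence (2·2) 6 B.X X fᵢ` (file
  `MotivatedClasses`, target first), `f₄(a ∪ a') = f₂ a ∪ f₂ a'`, `fᵢ` map rational classes to rational
  classes (an honest cycle acts on `H^•(–, ℚ)`), and `f₂` maps `(2,0)`-classes to `(2,0)`-classes.  WEAKER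
  than print (a submanifold is more than a correspondence), never stronger.
* §1.14 "non-zero holomorphic 2-form pulls back to a non-zero holomorphic 2-form", "injective map from
  `T_X` into `H²(B)`" ↦ `f₂ σ ≠ 0` for every non-zero class `σ` of type `(2,0)` and `f₂` injective on
  `transcendentalPart X b`.
* Thm. 0.3 / §1.13–1.14 ("`q_X^∨ = λ c₂(T_X)` is algebraic and pulls back to an algebraic Hodge–Weil class")
  ↦ two clauses.  (a) Marking-free: `∃ c ∈ algebraicClasses X 2`, rational, with `f₄ c` algebraic, rational,
  of type `(2,2)`, lying in `D² ⊗ ℂ ⊔ W_K ⊗ ℂ` (`Barriers.HodgeConjecture.divisorClassesSpan B.X B.dim 2 ⊔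
  weilClassesOf B ψ 2 (m²d)`) and NOT in `D² ⊗ ℂ` — verbatim the abstract's "an algebraic class in
  codimension two that is not an intersection of divisor classes".  LOCATED while typing (a located
  imprecision is a result): the sentence "the pull-back of `c₂(T_X)` is a Hodge-Weil class" holds only
  MODULO THE DIVISOR RING — `q_X^∨ = q_{NS(X)}^∨ + q_{T_X}^∨` along the `q_X`-orthogonal splitting
  `H²(X,ℚ) = NS(X)_ℚ ⊕ T_X` (`ρ(X) = 23 − 6 = 17`), and `f₄(q_{NS(X)}^∨)` is a combination of products of
  divisor classes of `B`, i.e. lies in `ℚ h²` for the very general `B`; the paper's own abstract and its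
  p0003:L14 "up to a complete intersection of divisors" say exactly this, and the proof (§1.14 with Prop.
  1.11: the `Sym²(T₁)`-component is a NON-ZERO element of `HW(B,K)`) proves exactly clause (a).  So (a) is
  the statement AS PROVED; the kernel below recovers "a non-zero algebraic Hodge–Weil class" from it.
  (b) Under a Beauville–Bogomolov marking `Hyperkaehler.IsMarkedK3Hilb 3 X φ P` (file
  `K3HilbertTypeMonodromy`): the dual BBF class `Hyperkaehler.dualBBFClass 3 φ (= ±q_X^∨)` is algebraic and
  `f₄` of it lies in `D² ⊗ ℂ ⊔ W_K ⊗ ℂ` and not in `D² ⊗ ℂ` — the NAMED class of the mechanism (vacuous until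
  a marking of `X` is exhibited; the existence of BBF markings of `K3^[n]`-type manifolds is not yet a tree
  record).
* NOT typed: `B′` and the isogeny `B′ → B` (Thm. 0.3's last sentence for `B′` is isogeny invariance, tree
  theorem `HodgeConjectureFor.of_isIsogenous`); the integral statements (`H²(B,ℤ)`, `q_X` on `H²(X,ℤ)`);
  `H⁴(X,ℤ) ≅ Sym²H² ⊕ H²(−1)` and `λ`, `c₂(T_X)³ = 36800` (no tangent-bundle Chern class on these carriers —
  `c₂(T_X)` enters only as the provenance of the algebraic class `c`); §§2–7 (Barnes–Wall lattice, the
  involution of `S^[3]`, the `K3^[3]` manifold `M ⊃ K(A × A)`, the deformation theory); the intro's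
  rank-two bundle `N₀` and its zero locus.

## Kernel (PROVED here, modulo the named facts fed as hypotheses)

* `….exists_weilClass_algebraic_ne_zero`: from clause (a), a NON-ZERO ALGEBRAIC class in the Weil plane of
  `B` (divisor monomials are algebraic: Lefschetz (1,1) `lefschetzOneOne_rational_holds` +
  `AbelianVariety.divisorClassesSpan_le_algebraicClasses`).
* `….weilClassesOf_le_algebraicClasses`: the whole Weil plane of `B` is algebraic ("using the `K`-action":
  `weilClassesOf_le_algebraicClasses_of_exists_ne_zero`, file `WeilClassesSixfoldsProofs`).
* `….hodgeConjectureFor`: the FULL Hodge conjecture for that `B` (van Geemen 1994 Thm. 6.12 for Hodge group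
  `SU_H`: `VanGeemen1994.hodgeConjectureFor_of_hasHodgeGroupSU_of_weilClasses`) — Theorem 0.1 at the member,
  by name.
* `hom_eq_zero_of_isIrreducible_of_isOfK3Type` (+ `_sixfold`): the MAP FORM of §1.15 for `n ≥ 3`, from the
  companion record `VanGeemenRapagnetta2026_K3Type_subHodgeStructures_generalWeilType`: every morphism of
  `ℚ`-Hodge structures from an irreducible structure of K3 type into `H²_B(A)` of a general Weil `2n`-fold,
  `n ≥ 3`, is zero (its image would be a K3-type sub-Hodge structure) — with the two generic lemmas
  `Hom.injective_or_eq_zero_of_isIrreducible`, `IsOfK3Type.range_of_injective`; and WITHOUT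
  irreducibility `map_piece_two_zero_eq_bot` (+ `_sixfold`): any Hodge morphism from a finite-dimensional
  weight-two structure with `h^{2,0} = 1` and no `|p−q| > 2` pieces (the shape of `H²(X, ℚ)` of any
  hyperkähler `X`) into `H²_B(A)` kills `V^{2,0}` ("`σ_X` pulls back to zero"; Hodge-number additivity and
  the first isomorphism theorem of `Motives/HodgeStructureQuotient`).
* `….exists_marking_dualBBFClass_witness`: clause (b) instantiated by the marking-existence record
  `Hyperkaehler.Rapagnetta2008_exists_isMarkedK3Hilb` (file `BeauvilleBogomolovMarkingsExist`): the host
  `X` carries a marking `φ`, and `dualBBFClass 3 φ = ±q_X^∨` IS an algebraic witness class.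
DERIVED LENS READING (not printed as such, not typed): a rational map `f : B ⇢ X` from a general Weil
SIXFOLD to a hyperkähler `2m`-fold therefore has `f^*σ_X = 0` (else `T_X ↪ H²(B,ℚ)`), i.e. its image is
`σ_X`-isotropic, of dimension `≤ m`: a hyperkähler host for `K(B⁶)` through `H²` needs `dim X ≥ 12` with
Lagrangian-type image, and a natural algebraic class in CODIMENSION THREE — no such statement is in print.
-/

noncomputable section

open CategoryTheory

namespace Literature.AlgebraicGeometry.HodgeTheory

open Literature.AlgebraicTopology.SingularHomology
open Literature.AlgebraicGeometry.Motives (AbelianVariety ProjectiveEmbedding projectiveSpace SchemeOver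
  IsSmoothProjective HodgeStructure)
open Literature.AlgebraicGeometry.Motives.HodgeStructure (SubHodgeStructure)
open Literature.AlgebraicGeometry.VanGeemen1994 (HasHodgeGroupSU)
open Literature.AlgebraicGeometry.Hyperkaehler (IsOfK3HilbertType IsFujikiForm transcendentalPart
  IsMarkedK3Hilb dualBBFClass K3HilbertIndex)
open Literature.Barriers.HodgeConjecture (divisorClassesSpan)

/-! ### Two generic lemmas on morphisms out of irreducible / K3-type Hodge structures -/

section HodgeLemmas

variable {V₁ V₂ : Type*} [AddCommGroup V₁] [Module ℚ V₁] [AddCommGroup V₂] [Module ℚ V₂]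

/-- A morphism of `ℚ`-Hodge structures out of an IRREDUCIBLE structure is injective or zero (its kernel
is a sub-Hodge structure, Voisin I Lemma 7.25, hence `0` or everything). [cite: Huybrechts2016K3, §3.3.3 and Lemma 3.2.7]
[cite: VoisinHodgeI2002, §7.3.1 Lemma 7.25] -/
theorem _root_.Literature.AlgebraicGeometry.Motives.HodgeStructure.Hom.injective_or_eq_zero_of_isIrreducible
    {n : ℤ} {H₁ : HodgeStructure V₁ n} {H₂ : HodgeStructure V₂ n} (hirr : H₁.IsIrreducible)
    (f : H₁.Hom H₂) : Function.Injective f.toLinearMap ∨ f.toLinearMap = 0 := by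
  rcases hirr.eq_bot_or_eq_top f.ker with h | h
  · left
    rw [HodgeStructure.Hom.ker_toSubmodule] at h
    exact LinearMap.ker_eq_bot.1 h
  · right
    rw [HodgeStructure.Hom.ker_toSubmodule] at h
    exact LinearMap.ker_eq_top.1 h

/-- The image of an INJECTIVE morphism out of a Hodge structure of K3 type is of K3 type (Hodge numbers
and pieces are transported along the bijective co-restriction, Voisin I Cor. 7.24).
[cite: Huybrechts2016K3, Def. 3.2.3] [cite: VoisinHodgeI2002, §7.3.1 Cor. 7.24] -/
theorem _root_.Literature.AlgebraicGeometry.Motives.HodgeStructure.IsOfK3Type.range_of_injective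
    {H₁ : HodgeStructure V₁ 2} {H₂ : HodgeStructure V₂ 2} (hK3 : H₁.IsOfK3Type) (f : H₁.Hom H₂)
    (hf : Function.Injective f.toLinearMap) : f.range.toHodgeStructure.IsOfK3Type := by
  refine ⟨by rw [f.hodgeNumber_range_of_injective hf]; exact hK3.1, fun p q hpq ↦ ?_⟩
  rw [← f.rangeRestrict.map_piece_eq_of_bijective (f.rangeRestrict_bijective_of_injective hf) p q,
    hK3.2 p q hpq, Submodule.map_bot]

end HodgeLemmas

/-! ### §1.15 in map form (kernel, from the companion record): no K3-type Hodge structure maps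
non-trivially into `H²` of a general Weil `2n`-fold, `n ≥ 3` -/

section NoHost

variable {A : AbelianVariety ℂ} {φ : A ⟶ A} {n d : ℕ}

/-- **Van Geemen–Rapagnetta §1.15, map form (rung H2): for a general abelian variety of Weil type of
dimension `2n ≥ 6` (Hodge group `SU_H`), EVERY morphism of `ℚ`-Hodge structures from an irreducible Hodge
structure of K3 type into `H²_B(A)` is ZERO** — "a general abelian variety `B` of Weil type of dimension `2n`
for `n > 2` does not have Hodge structures of K3 type in `H²(B,ℚ)` […] hence in this case there cannot exist
such a map to a hyperkähler manifold": an injective such morphism would have a K3-type image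
(`IsOfK3Type.range_of_injective`), excluded by `…noK3Type_of_three_le`; a morphism out of an irreducible
structure is injective or zero.  In particular no correspondence embeds the (irreducible, K3-type)
transcendental lattice `T_X ⊂ H²(X, ℚ)` of a projective hyperkähler `X` into `H²` of a general Weil `2n`-fold,
`n ≥ 3`.  PROVED modulo the companion record. [cite: vanGeemenRapagnetta2026WeilHK, §1.15 (p0013:L34–L47)] -/
theorem VanGeemenRapagnetta2026_K3Type_subHodgeStructures_generalWeilType.hom_eq_zero_of_isIrreducible_of_isOfK3Type
    (h : VanGeemenRapagnetta2026_K3Type_subHodgeStructures_generalWeilType)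
    (e : ProjectiveEmbedding A.X) {a : complexBetti (projectiveSpace e.n ℂ) 2} (hn : 3 ≤ n)
    (hW : IsWeilType A φ n d) (ha : IsRationalClass a) (ha0 : a ≠ 0)
    (hSU : HasHodgeGroupSU A φ n d
      ((d : ℂ) • complexBetti.map e.ι 2 a + complexBetti.map φ.hom.hom.hom 2 (complexBetti.map e.ι 2 a)))
    (M : HodgeModel A.dim A.X) (hM : M.IsHodgeSymmetric)
    {V : Type} [AddCommGroup V] [Module ℚ V] {HV : HodgeStructure V 2} (hirr : HV.IsIrreducible)
    (hK3 : HV.IsOfK3Type) (g : HV.Hom (abelianBettiTwoHodgeStructure A M hM)) :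
    g.toLinearMap = 0 := by
  rcases g.injective_or_eq_zero_of_isIrreducible hirr with hinj | h0
  · exact absurd (hK3.range_of_injective g hinj) (h.noK3Type_of_three_le e hn hW ha ha0 hSU M hM g.range)
  · exact h0

/-- **The SIXFOLD instance (ladder HodgeAV, rung H2):** for a general abelian sixfold of Weil type, every
`K = ℚ(√-d)`, every discriminant, every Hodge morphism from an irreducible K3-type `ℚ`-Hodge structure into
`H²_B(A)` vanishes — the "Kummer variety inside a hyperkähler host" lens of this file is closed THROUGH `H²`
at `n = 3`. [cite: vanGeemenRapagnetta2026WeilHK, §1.15 (p0013:L41–L47)] -/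
theorem VanGeemenRapagnetta2026_K3Type_subHodgeStructures_generalWeilType.hom_eq_zero_sixfold
    (h : VanGeemenRapagnetta2026_K3Type_subHodgeStructures_generalWeilType)
    (e : ProjectiveEmbedding A.X) {a : complexBetti (projectiveSpace e.n ℂ) 2}
    (hW : IsWeilType A φ 3 d) (ha : IsRationalClass a) (ha0 : a ≠ 0)
    (hSU : HasHodgeGroupSU A φ 3 d
      ((d : ℂ) • complexBetti.map e.ι 2 a + complexBetti.map φ.hom.hom.hom 2 (complexBetti.map e.ι 2 a)))
    (M : HodgeModel A.dim A.X) (hM : M.IsHodgeSymmetric)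
    {V : Type} [AddCommGroup V] [Module ℚ V] {HV : HodgeStructure V 2} (hirr : HV.IsIrreducible)
    (hK3 : HV.IsOfK3Type) (g : HV.Hom (abelianBettiTwoHodgeStructure A M hM)) :
    g.toLinearMap = 0 :=
  h.hom_eq_zero_of_isIrreducible_of_isOfK3Type e le_rfl hW ha ha0 hSU M hM hirr hK3 g

/-- **§1.15 in map form WITHOUT irreducibility ("`σ_X` pulls back to zero"): for a general Weil `2n`-fold,
`n ≥ 3`, every morphism of `ℚ`-Hodge structures `g : V → H²_B(A)` from a finite-dimensional weight-two
structure with `h^{2,0}(V) = 1` and `V^{p,q} = 0` for `|p−q| > 2` (the shape of `H²(X, ℚ)` of ANY compact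
hyperkähler `X`, projective or not — no transcendental lattice needed) KILLS `V^{2,0}`:
`g_ℂ(V^{2,0}) = 0`.**  Otherwise `ker g` misses the line `V^{2,0}`, so `h^{2,0}(V / ker g) = 1`
(additivity of Hodge numbers), the image `im g ≅ V / ker g` has `h^{2,0} = 1` and no pieces with
`|p−q| > 2` (pieces of the quotient are images of pieces), i.e. is of K3 type — excluded by
`…noK3Type_of_three_le`.  This is the typed core of the ladder reading "a rational map from a general Weil
sixfold to a hyperkähler manifold has `σ`-isotropic image". [cite: vanGeemenRapagnetta2026WeilHK, §1.15 (p0013:L34–L47)]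
[cite: VoisinHodgeI2002, §7.3.1 Cor. 7.24 (pieces of the image)] -/
theorem VanGeemenRapagnetta2026_K3Type_subHodgeStructures_generalWeilType.map_piece_two_zero_eq_bot
    (h : VanGeemenRapagnetta2026_K3Type_subHodgeStructures_generalWeilType)
    (e : ProjectiveEmbedding A.X) {a : complexBetti (projectiveSpace e.n ℂ) 2} (hn : 3 ≤ n)
    (hW : IsWeilType A φ n d) (ha : IsRationalClass a) (ha0 : a ≠ 0)
    (hSU : HasHodgeGroupSU A φ n d
      ((d : ℂ) • complexBetti.map e.ι 2 a + complexBetti.map φ.hom.hom.hom 2 (complexBetti.map e.ι 2 a)))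
    (M : HodgeModel A.dim A.X) (hM : M.IsHodgeSymmetric)
    {V : Type} [AddCommGroup V] [Module ℚ V] [Module.Finite ℚ V] {HV : HodgeStructure V 2}
    (h20 : HV.hodgeNumber 2 0 = 1) (hpq : ∀ p q : ℤ, 2 < |p - q| → HV.piece p q = ⊥)
    (g : HV.Hom (abelianBettiTwoHodgeStructure A M hM)) :
    (HV.piece 2 0).map (g.toLinearMap.baseChange ℂ) = ⊥ := by
  by_contra hne
  -- (A) the kernel misses the `(2,0)`-line
  have hinf : g.ker.toSubmodule.baseChange ℂ ⊓ HV.piece 2 0 = ⊥ := by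
    rw [eq_bot_iff]
    rintro x ⟨hxK, hxP⟩
    have hx0 : g.toLinearMap.baseChange ℂ x = 0 :=
      (HodgeStructure.mem_baseChange_ker_iff g.toLinearMap x).1 hxK
    by_contra hx
    apply hne
    haveI : Module.Finite ℂ (HV.piece 2 0) := Module.finite_of_finrank_eq_succ (n := 0) h20
    have hspan : Submodule.span ℂ {(⟨x, hxP⟩ : HV.piece 2 0)} = ⊤ := by
      apply Submodule.eq_top_of_finrank_eq
      rw [finrank_span_singleton (by exact fun h0 ↦ hx (congrArg Subtype.val h0))]
      exact h20.symm
    rw [eq_bot_iff]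
    rintro _ ⟨w, hw, rfl⟩
    have hw' : (⟨w, hw⟩ : HV.piece 2 0) ∈ Submodule.span ℂ {(⟨x, hxP⟩ : HV.piece 2 0)} := by
      rw [hspan]; exact Submodule.mem_top
    obtain ⟨c, hc⟩ := Submodule.mem_span_singleton.1 hw'
    have hcw : c • x = w := congrArg Subtype.val hc
    rw [Submodule.mem_bot, ← hcw, map_smul, hx0, smul_zero]
  -- (B) `h^{2,0}(ker g) = 0`, hence `h^{2,0}(V / ker g) = 1`
  have hK0 : g.ker.toHodgeStructure.hodgeNumber 2 0 = 0 := by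
    rw [g.ker.hodgeNumber_eq_finrank_inf, hinf, finrank_bot]
  have hQ : (HV.quotient g.ker).hodgeNumber 2 0 = 1 := by
    have hadd := HodgeStructure.hodgeNumber_quotient_add g.ker 2 0
    rw [hK0, h20, add_zero] at hadd
    exact hadd
  -- (C) transport to the image along `V / ker g ≅ im g`
  have hbij := g.quotKerToRange_bijective
  have hR : g.range.toHodgeStructure.hodgeNumber 2 0 = 1 := by
    rw [← g.quotKerToRange.hodgeNumber_eq_of_bijective hbij 2 0]
    exact hQ
  have hRp : ∀ p q : ℤ, 2 < |p - q| → g.range.toHodgeStructure.piece p q = ⊥ := fun p q hpq' ↦ by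
    rw [← g.quotKerToRange.map_piece_eq_of_bijective hbij p q, HodgeStructure.quotient_piece_eq_map,
      hpq p q hpq', Submodule.map_bot, Submodule.map_bot]
  exact h.noK3Type_of_three_le e hn hW ha ha0 hSU M hM g.range ⟨hR, hRp⟩

/-- The SIXFOLD instance of `map_piece_two_zero_eq_bot` (rung H2): a Hodge morphism from any
`h^{2,0} = 1` weight-two structure (e.g. `H²` of any hyperkähler manifold) into `H²_B` of a general Weil
sixfold kills the `(2,0)`-part. [cite: vanGeemenRapagnetta2026WeilHK, §1.15 (p0013:L41–L47)] -/
theorem VanGeemenRapagnetta2026_K3Type_subHodgeStructures_generalWeilType.map_piece_two_zero_eq_bot_sixfold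
    (h : VanGeemenRapagnetta2026_K3Type_subHodgeStructures_generalWeilType)
    (e : ProjectiveEmbedding A.X) {a : complexBetti (projectiveSpace e.n ℂ) 2}
    (hW : IsWeilType A φ 3 d) (ha : IsRationalClass a) (ha0 : a ≠ 0)
    (hSU : HasHodgeGroupSU A φ 3 d
      ((d : ℂ) • complexBetti.map e.ι 2 a + complexBetti.map φ.hom.hom.hom 2 (complexBetti.map e.ι 2 a)))
    (M : HodgeModel A.dim A.X) (hM : M.IsHodgeSymmetric)
    {V : Type} [AddCommGroup V] [Module ℚ V] [Module.Finite ℚ V] {HV : HodgeStructure V 2}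
    (h20 : HV.hodgeNumber 2 0 = 1) (hpq : ∀ p q : ℤ, 2 < |p - q| → HV.piece p q = ⊥)
    (g : HV.Hom (abelianBettiTwoHodgeStructure A M hM)) :
    (HV.piece 2 0).map (g.toLinearMap.baseChange ℂ) = ⊥ :=
  h.map_piece_two_zero_eq_bot e le_rfl hW ha ha0 hSU M hM h20 hpq g

end NoHost

/-! ### van Geemen–Rapagnetta 2026, Theorems 0.2 and 0.3 — the named fact -/

section Facts

/-- The conjunction of clauses recording, for a pull-back pair `(f₂, f₄)` along `B ⇢ K(B) ⊂ X`, what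
§1.14 proves about a class `c ∈ H⁴(X(ℂ); ℂ)` (intended: `c = q_X^∨ = λ c₂(T_X)`): `c` is a rational algebraic
class on `X`, and `f₄ c` is a rational algebraic class of Hodge type `(2,2)` on `B` lying in
`D² ⊗ ℂ ⊔ W_K ⊗ ℂ` but NOT in the divisor part `D² ⊗ ℂ` ("an algebraic class in codimension two that is not
an intersection of divisor classes"; "pulls back to a Hodge-Weil class" modulo the divisor ring — module
docstring, LOCATED).  An abbreviation used twice in the fact below, not a notion.
[cite: vanGeemenRapagnetta2026WeilHK, Abstract (p0001:L6–L8) and §1.14 (p0013:L22–L30)] -/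
def IsWeilClassPullbackWitness (B : AbelianVariety ℂ) (ψ : B ⟶ B) (d' : ℕ) (X : SchemeOver ℂ)
    (f₄ : complexBetti X (2 * 2) →ₗ[ℂ] complexBetti B.X (2 * 2)) (c : complexBetti X (2 * 2)) : Prop :=
  IsRationalClass c ∧ c ∈ algebraicClasses X 2 ∧
    IsRationalClass (f₄ c) ∧ IsOfHodgeType (2 * 2) B.X (2 * 2) 2 2 (f₄ c) ∧ f₄ c ∈ algebraicClasses B.X 2 ∧
      f₄ c ∈ divisorClassesSpan B.X B.dim 2 ⊔ weilClassesOf B ψ 2 d' ∧ f₄ c ∉ divisorClassesSpan B.X B.dim 2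

/-- Unfolding lemma. [cite: vanGeemenRapagnetta2026WeilHK, §1.14] -/
theorem isWeilClassPullbackWitness_iff {B : AbelianVariety ℂ} {ψ : B ⟶ B} {d' : ℕ} {X : SchemeOver ℂ}
    {f₄ : complexBetti X (2 * 2) →ₗ[ℂ] complexBetti B.X (2 * 2)} {c : complexBetti X (2 * 2)} :
    IsWeilClassPullbackWitness B ψ d' X f₄ c ↔
      IsRationalClass c ∧ c ∈ algebraicClasses X 2 ∧
        IsRationalClass (f₄ c) ∧ IsOfHodgeType (2 * 2) B.X (2 * 2) 2 2 (f₄ c) ∧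
          f₄ c ∈ algebraicClasses B.X 2 ∧
            f₄ c ∈ divisorClassesSpan B.X B.dim 2 ⊔ weilClassesOf B ψ 2 d' ∧
              f₄ c ∉ divisorClassesSpan B.X B.dim 2 :=
  Iff.rfl

/-- **van Geemen–Rapagnetta 2026, Theorem 0.2 ∧ Theorem 0.3 (with §1.13–1.14): for every imaginary
quadratic field `K = ℚ(√-d)` there is a discriminant-one abelian fourfold `B` of `K`-Weil type, with Hodge
group `SU_H` (print: isogenous to a very general one), whose Kummer variety `K(B)` is a submanifold of a
PROJECTIVE hyperkähler SIXFOLD `X` of `K3^[3]` type with `dim T_X = 6`; along `B ⇢ K(B) ⊂ X` the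
transcendental lattice `T_X` injects into `H²(B)`, and the natural algebraic class `q_X^∨ = λ c₂(T_X)` of `X`
pulls back to an algebraic codimension-two class of `B` which is not an intersection of divisor classes
(equivalently, a Hodge–Weil class modulo the divisor ring) — whence all Hodge–Weil classes of `B` are
algebraic.**  Rendering (module docstring): `∃ m > 0, (B, ψ)` with `IsSplitWeilType B ψ 2 (m²d)` and
`HasHodgeGroupSU` for a `K`-symmetrised hyperplane class; `∃ X` with `IsSmoothProjective 6 X`,
`IsOfK3HilbertType 3 X`, `finrank (transcendentalPart X b) = 6` for every Fujiki form `b`; `∃ (f₂, f₄)`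
pull-backs in degrees `2`, `4` induced by algebraic correspondences on `B × X` (the graph closure of
`B ⇢ X`), multiplicative, rational, `f₂` type-`(2,0)`-preserving, non-zero on non-zero `(2,0)`-classes and
injective on `transcendentalPart X b`; a witness class `c` with `IsWeilClassPullbackWitness` (clause (a));
and, for every Beauville–Bogomolov marking `(φ, P)` of `X`, the same for `dualBBFClass 3 φ` (clause (b)).
WEAKER than print where marked in the module docstring (existential member; correspondences instead of the
submanifold `K(B)`); the Hodge–Weil sentence is typed AS PROVED (modulo divisor classes — located).
GRADE: **PREPRINT** (arXiv:2607.18341, July 2026; unrefereed).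
[cite: vanGeemenRapagnetta2026WeilHK, Thm. 0.2 (p0002:L17–L21), Thm. 0.3 (p0002:L26–L31), §1.13 (p0012:L32–p0013:L9), §1.14 (p0013:L10–L33), Prop. 1.11 (p0011:L32–p0012:L25), §7.1 (p0047:L20–L30)]
[cite: FloccariFu2026, Thm. 1.3 (the OG6 form of the mechanism, cited p0002:L15–L16)] -/
def VanGeemenRapagnetta2026_kummerOfDiscOneWeilFourfold_inK3CubeType : Prop :=
  ∀ d : ℕ, 0 < d →
    ∃ (m : ℕ) (B : AbelianVariety ℂ) (ψ : B ⟶ B), 0 < m ∧ IsSplitWeilType B ψ 2 (m ^ 2 * d) ∧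
      (∃ (e : ProjectiveEmbedding B.X) (a : complexBetti (projectiveSpace e.n ℂ) 2),
        IsRationalClass a ∧ a ≠ 0 ∧
          HasHodgeGroupSU B ψ 2 (m ^ 2 * d)
            (((m ^ 2 * d : ℕ) : ℂ) • complexBetti.map e.ι 2 a +
              complexBetti.map ψ.hom.hom.hom 2 (complexBetti.map e.ι 2 a))) ∧
      ∃ (X : SchemeOver ℂ), IsSmoothProjective 6 X ∧ IsOfK3HilbertType 3 X ∧
        (∀ b : complexBetti X 2 →ₗ[ℂ] complexBetti X 2 →ₗ[ℂ] ℂ, IsFujikiForm 3 X b →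
          Module.finrank ℂ (transcendentalPart X b) = 6) ∧
        ∃ (f₂ : complexBetti X 2 →ₗ[ℂ] complexBetti B.X 2)
          (f₄ : complexBetti X (2 * 2) →ₗ[ℂ] complexBetti B.X (2 * 2)),
          IsAlgebraicCorrespondence (2 * 2) 6 B.X X f₂ ∧ IsAlgebraicCorrespondence (2 * 2) 6 B.X X f₄ ∧
          (∀ x y : complexBetti X 2,
            f₄ (cupProduct (rfl : 2 + 2 = 2 * 2) x y) = cupProduct (rfl : 2 + 2 = 2 * 2) (f₂ x) (f₂ y)) ∧
          (∀ x : complexBetti X 2, IsRationalClass x → IsRationalClass (f₂ x)) ∧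
          (∀ x : complexBetti X (2 * 2), IsRationalClass x → IsRationalClass (f₄ x)) ∧
          (∀ σ : complexBetti X 2, IsOfHodgeType 6 X 2 2 0 σ → IsOfHodgeType (2 * 2) B.X 2 2 0 (f₂ σ)) ∧
          (∀ σ : complexBetti X 2, IsOfHodgeType 6 X 2 2 0 σ → σ ≠ 0 → f₂ σ ≠ 0) ∧
          (∀ b : complexBetti X 2 →ₗ[ℂ] complexBetti X 2 →ₗ[ℂ] ℂ, IsFujikiForm 3 X b →
            ∀ x ∈ transcendentalPart X b, f₂ x = 0 → x = 0) ∧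
          (∃ c : complexBetti X (2 * 2), IsWeilClassPullbackWitness B ψ (m ^ 2 * d) X f₄ c) ∧
          (∀ (φ : complexBetti X 2 ≃ₗ[ℂ] (K3HilbertIndex → ℂ)) (P : complexBetti X (2 * (2 * 3))),
            IsMarkedK3Hilb 3 X φ P → IsWeilClassPullbackWitness B ψ (m ^ 2 * d) X f₄ (dualBBFClass 3 φ))

end Facts

/-! ### Kernel: what the fact gives by name -/

namespace VanGeemenRapagnetta2026_kummerOfDiscOneWeilFourfold_inK3CubeType

variable {B : AbelianVariety ℂ} {ψ : B ⟶ B} {d' : ℕ} {X : SchemeOver ℂ}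
  {f₄ : complexBetti X (2 * 2) →ₗ[ℂ] complexBetti B.X (2 * 2)} {c : complexBetti X (2 * 2)}

/-- **From the pulled-back class to a NON-ZERO ALGEBRAIC Hodge–Weil class** ("up to a complete
intersection of divisors, defines a Hodge-Weil class"): write `f₄ c = δ + w` with `δ ∈ D² ⊗ ℂ`,
`w ∈ W_K ⊗ ℂ`; `w ≠ 0` since `f₄ c ∉ D² ⊗ ℂ`; `δ` is algebraic (divisor monomials of an abelian variety are
algebraic by Lefschetz `(1,1)`, `AbelianVariety.divisorClassesSpan_le_algebraicClasses`), hence so is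
`w = f₄ c − δ`. [cite: vanGeemenRapagnetta2026WeilHK, §1.14 (p0013:L22–L30) and Introduction (p0003:L12–L16)] -/
theorem exists_weilClass_algebraic_ne_zero (hc : IsWeilClassPullbackWitness B ψ d' X f₄ c) :
    ∃ w ∈ weilClassesOf B ψ 2 d', w ∈ algebraicClasses B.X 2 ∧ w ≠ 0 := by
  obtain ⟨-, -, -, -, halg, hmem, hnot⟩ := hc
  obtain ⟨δ, hδ, w, hw, hsum⟩ := Submodule.mem_sup.1 hmem
  have h11 : ∀ b : complexBetti B.X (2 * 1), IsRationalClass b → IsOfHodgeType B.dim B.X (2 * 1) 1 1 b →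
      b ∈ algebraicClasses B.X 1 :=
    fun b hb hb' ↦ lefschetzOneOne_rational_holds
      (Motives.AbelianVariety.isSmoothProjective_holds (A := B)) b hb hb'
  have hδalg : δ ∈ algebraicClasses B.X 2 :=
    AbelianVariety.divisorClassesSpan_le_algebraicClasses B h11 2 hδ
  refine ⟨w, hw, ?_, ?_⟩
  · have : w = f₄ c - δ := by rw [← hsum]; abel
    rw [this]
    exact Submodule.sub_mem _ halg hδalg
  · rintro rfl
    apply hnot
    rw [← hsum, add_zero]
    exact hδ

/-- **Theorem 0.3, last sentence, for the member `B`: all Hodge–Weil classes of `B` are algebraic** ("this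
implies, using the `K`–action, that then all Hodge-Weil classes in `B` are algebraic" — the tree's
`weilClassesOf_le_algebraicClasses_of_exists_ne_zero`, with `H^•(B(ℂ)) = ⋀^•H¹` and `b₁ = 8` from the
abelian-variety records). [cite: vanGeemenRapagnetta2026WeilHK, Thm. 0.3 (p0002:L30–L31) and §1.14 (p0013:L31–L33)] -/
theorem weilClassesOf_le_algebraicClasses_of_witness (hB : IsSplitWeilType B ψ 2 d')
    (hc : IsWeilClassPullbackWitness B ψ d' X f₄ c) :
    weilClassesOf B ψ 2 d' ≤ algebraicClasses B.X 2 := by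
  have hW := hB.isWeilType
  have hb₁ : Module.finrank ℂ (complexBetti B.X 1) = 2 * (2 * 2) := by
    rw [Motives.AbelianVariety.finrank_complexBetti_one, hW.dim_eq]
  exact weilClassesOf_le_algebraicClasses_of_exists_ne_zero hW.pos hW.d_pos hW.sq_eq
    (Motives.AbelianVariety.hasExteriorCohomologyH1_complexPoints B) hb₁
    (let ⟨w, hw, halg, h0⟩ := exists_weilClass_algebraic_ne_zero hc; ⟨w, hw, halg, h0⟩)

/-- **The fact, by name: for every `K = ℚ(√-d)` it exhibits a discriminant-one `K`-Weil fourfold `B` with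
Hodge group `SU_H`, inside whose `H⁴` the Weil plane is ALGEBRAIC** (Theorem 0.1 at the member).
[cite: vanGeemenRapagnetta2026WeilHK, Thm. 0.3 and Thm. 0.1] -/
theorem weilClassesOf_le_algebraicClasses
    (h : VanGeemenRapagnetta2026_kummerOfDiscOneWeilFourfold_inK3CubeType) {d : ℕ} (hd : 0 < d) :
    ∃ (m : ℕ) (B : AbelianVariety ℂ) (ψ : B ⟶ B), 0 < m ∧ IsSplitWeilType B ψ 2 (m ^ 2 * d) ∧
      weilClassesOf B ψ 2 (m ^ 2 * d) ≤ algebraicClasses B.X 2 := by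
  obtain ⟨m, B, ψ, hm, hB, -, X, -, -, -, f₂, f₄, -, -, -, -, -, -, -, -, ⟨c, hc⟩, -⟩ := h d hd
  exact ⟨m, B, ψ, hm, hB, weilClassesOf_le_algebraicClasses_of_witness hB hc⟩

/-- **The FULL Hodge conjecture for the member `B`** (every rational `(p,p)`-class of `B` algebraic): the
Weil plane is algebraic (above) and the Hodge group is `SU_H`, so van Geemen 1994 Thm. 6.12 (the Hodge ring
of such `B` is generated by divisors and the Weil plane; tree theorem
`VanGeemen1994.hodgeConjectureFor_of_hasHodgeGroupSU_of_weilClasses`, modulo its named fact inside) closes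
it. [cite: vanGeemenRapagnetta2026WeilHK, Thm. 0.1 and Thm. 0.3] [cite: vanGeemen1994HodgeAV, Thm. 6.12] -/
theorem hodgeConjectureFor
    (h : VanGeemenRapagnetta2026_kummerOfDiscOneWeilFourfold_inK3CubeType) {d : ℕ} (hd : 0 < d) :
    ∃ (m : ℕ) (B : AbelianVariety ℂ) (ψ : B ⟶ B), 0 < m ∧ IsSplitWeilType B ψ 2 (m ^ 2 * d) ∧
      HodgeConjectureFor B.dim B.X := by
  obtain ⟨m, B, ψ, hm, hB, ⟨e, a, ha, ha0, hSU⟩, X, -, -, -, f₂, f₄, -, -, -, -, -, -, -, -, ⟨c, hc⟩, -⟩ :=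
    h d hd
  have hW := hB.isWeilType
  refine ⟨m, B, ψ, hm, hB, ?_⟩
  exact VanGeemen1994.hodgeConjectureFor_of_hasHodgeGroupSU_of_weilClasses e le_rfl hW.d_pos hW.dim_eq
    hW.sq_eq (fun c hc ↦ hW.isOfHodgeType_of_mem_weilClassesOf hc) ha ha0 hSU
    (fun x _ _ hx ↦ weilClassesOf_le_algebraicClasses_of_witness hB hc hx)

/-- **The host, by name (rung H2 transfer lens, `n = 2`): for every `K = ℚ(√-d)` there are a
discriminant-one `K`-Weil fourfold `B` and a projective `K3^[3]`-type sixfold `X` with `dim T_X = 6` and a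
degree-`2` pull-back `H²(X) → H²(B)` induced by an algebraic correspondence which is injective on the
transcendental part `T_X ⊗ ℂ`** — the clause whose `n = 3` analogue is refuted by
`…hom_eq_zero_sixfold`. [cite: vanGeemenRapagnetta2026WeilHK, Thm. 0.2 and §1.14 (p0013:L12–L16)] -/
theorem exists_host (h : VanGeemenRapagnetta2026_kummerOfDiscOneWeilFourfold_inK3CubeType) {d : ℕ}
    (hd : 0 < d) :
    ∃ (m : ℕ) (B : AbelianVariety ℂ) (ψ : B ⟶ B) (X : SchemeOver ℂ)
      (f₂ : complexBetti X 2 →ₗ[ℂ] complexBetti B.X 2),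
      0 < m ∧ IsSplitWeilType B ψ 2 (m ^ 2 * d) ∧ IsSmoothProjective 6 X ∧ IsOfK3HilbertType 3 X ∧
        (∀ b : complexBetti X 2 →ₗ[ℂ] complexBetti X 2 →ₗ[ℂ] ℂ, IsFujikiForm 3 X b →
          Module.finrank ℂ (transcendentalPart X b) = 6) ∧
        IsAlgebraicCorrespondence (2 * 2) 6 B.X X f₂ ∧
        (∀ b : complexBetti X 2 →ₗ[ℂ] complexBetti X 2 →ₗ[ℂ] ℂ, IsFujikiForm 3 X b →
          ∀ x ∈ transcendentalPart X b, f₂ x = 0 → x = 0) := by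
  obtain ⟨m, B, ψ, hm, hB, -, X, hX, hK3, hT, f₂, f₄, hf₂, -, -, -, -, -, -, hinj, -, -⟩ := h d hd
  exact ⟨m, B, ψ, X, f₂, hm, hB, hX, hK3, hT, hf₂, hinj⟩

/-- **Clause (b) is NOT vacuous: the host `X` carries a Beauville–Bogomolov marking `φ` (record
`Hyperkaehler.Rapagnetta2008_exists_isMarkedK3Hilb`, Beauville 1983 / Rapagnetta 2008), and for it the
NAMED class `dualBBFClass 3 φ = ±q_X^∨` is algebraic on `X` and pulls back along `f₄` to an algebraic
codimension-two class of `B` off the divisor ring** — the mechanism of Thm. 0.3 with its own class, by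
name. [cite: vanGeemenRapagnetta2026WeilHK, Thm. 0.3 and §1.13–1.14] [cite: Rapagnetta2007, Introduction (table row X^[n]) and Thm. 3.0.9] -/
theorem exists_marking_dualBBFClass_witness
    (h : VanGeemenRapagnetta2026_kummerOfDiscOneWeilFourfold_inK3CubeType)
    (hmk : Hyperkaehler.Rapagnetta2008_exists_isMarkedK3Hilb) {d : ℕ} (hd : 0 < d) :
    ∃ (m : ℕ) (B : AbelianVariety ℂ) (ψ : B ⟶ B) (X : SchemeOver ℂ)
      (f₄ : complexBetti X (2 * 2) →ₗ[ℂ] complexBetti B.X (2 * 2))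
      (φ : complexBetti X 2 ≃ₗ[ℂ] (K3HilbertIndex → ℂ)) (P : complexBetti X (2 * (2 * 3))),
      0 < m ∧ IsSplitWeilType B ψ 2 (m ^ 2 * d) ∧ IsSmoothProjective 6 X ∧ IsOfK3HilbertType 3 X ∧
        IsAlgebraicCorrespondence (2 * 2) 6 B.X X f₄ ∧ IsMarkedK3Hilb 3 X φ P ∧
        IsWeilClassPullbackWitness B ψ (m ^ 2 * d) X f₄ (dualBBFClass 3 φ) := by
  obtain ⟨m, B, ψ, hm, hB, -, X, hX, hK3, -, f₂, f₄, -, hf₄, -, -, -, -, -, -, -, hmark⟩ := h d hd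
  obtain ⟨φ, P, -, hφ, -⟩ := hmk 3 (by norm_num) X hX hK3
  exact ⟨m, B, ψ, X, f₄, φ, P, hm, hB, hX, hK3, hf₄, hφ, hmark φ P hφ⟩

end VanGeemenRapagnetta2026_kummerOfDiscOneWeilFourfold_inK3CubeType

end Literature.AlgebraicGeometry.HodgeTheory

end
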